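import Summits.PneNP.PneNP.Theorems.SymmetryBudgetNoHiddenOrderBranchSum

/-!
# BranchSum IV: transition data of an individualisation–refinement–section process

CG84-FLATNESS.md §9.3, item T2 reduced to its combinatorial core.  The hypotheses H1b (cells nest)
and H4 (a removed vertex is homogeneous to every LATER cell) of `BranchSum.RefinementPath` are not
primitive for the Corneil–Goldberg process; what the process gives directly, per transition
`k → k+1`, is an intermediate colouring `colStar k` of `W k` (the equitable refinement after
individualising `x_k`) such that

* `colStar k` refines `col k`, and the cells of node `k+1` lie inside `colStar k`-classes
  (restriction to the section part taken, possibly refined further);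
* every vertex dropped at the transition is homogeneous to every `colStar k`-class it leaves behind:
  for the individualised vertex this is equitability of `colStar k` w.r.t. its singleton class, for a
  vertex in another part of a section it is B. Laubner, PhD thesis (HU Berlin 2011), Def. 3.3.1.

`TransitionData` records exactly this; `TransitionData.toRefinementPath` derives H1b and H4 (by
induction over the node at which the vertex is dropped) and `TransitionData.sum_d_le` restates the
branch-sum bound `Σ_{k<N} d k ≤ 6·|V|·Nat.log 2 |V|` for transition data.  What remains outside Lean
for the memo's Cor. 9.2 is only that the CG84 algorithm with component sections produces transition
data with `d k = |A_k|` (definitional bookkeeping of the algorithm) and the label-disorder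
inequalities / circuit compilation.
-/

namespace Summit.PneNP.PneNP.Theorems

open Finset

namespace BranchSum

variable {V : Type*} [DecidableEq V] (G : SimpleGraph V) [DecidableRel G.Adj]

/-- TRANSITION DATA of an individualisation/refinement/section process (CG84-FLATNESS §9.0): at every
node `k` a vertex set `W k` with a colouring `col k` (the stable, sectionless ordered partition) and a
branching number `d k`; between node `k` and node `k+1` an intermediate colouring `colStar k` of `W k`
(the refinement after individualising) such that
* `colStar k` refines `col k` on `W k` (`star_refines`),
* the cells of node `k+1` lie inside `colStar k`-classes (`next_refines`: restriction to the part
  taken, possibly refined further),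
* every vertex dropped between the two nodes is HOMOGENEOUS to every `colStar k`-class it leaves
  behind (`dropped_homogeneous`): this is Laubner's Def. 3.3.1 for a vertex in another part of a
  section, and equitability w.r.t. the singleton class of the individualised vertex.
The remaining fields are those of `RefinementPath` that concern single nodes. -/
structure TransitionData (N : ℕ) where
  /-- vertex set at node `k` -/
  W : ℕ → Finset V
  /-- colouring at node `k` -/
  col : ℕ → V → ℕ
  /-- intermediate colouring of `W k` after the individualisation at node `k` -/
  colStar : ℕ → V → ℕ
  /-- branching number at node `k` -/
  d : ℕ → ℕ
  /-- vertex sets shrink -/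
  nest : ∀ k, W (k + 1) ⊆ W k
  /-- after the last node nothing is left -/
  final : W N = ∅
  /-- the intermediate colouring refines the node colouring -/
  star_refines : ∀ k, ∀ u ∈ W k, ∀ v ∈ W k, colStar k u = colStar k v → col k u = col k v
  /-- the next node's cells lie inside intermediate classes -/
  next_refines : ∀ k, ∀ u ∈ W (k + 1), ∀ v ∈ W (k + 1), col (k + 1) u = col (k + 1) v →
    colStar k u = colStar k v
  /-- a dropped vertex is homogeneous to every intermediate class it leaves behind -/
  dropped_homogeneous : ∀ k, ∀ v ∈ W k, v ∉ W (k + 1) → ∀ u ∈ W (k + 1), ∀ u' ∈ W (k + 1),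
    colStar k u = colStar k u' → (G.Adj v u ↔ G.Adj v u')
  /-- cells have at least two elements -/
  two_le : ∀ k, ∀ u ∈ W k, 2 ≤ (cellOf (W k) (col k) u).card
  /-- `d k` is at most every cell size at node `k` -/
  d_le : ∀ k, ∀ u ∈ W k, d k ≤ (cellOf (W k) (col k) u).card
  /-- the node partitions are equitable -/
  equitable : ∀ k, ∀ u ∈ W k, ∀ v ∈ W k, col k u = col k v → ∀ w ∈ W k,
    ((cellOf (W k) (col k) w).filter fun y => G.Adj u y).card =
      ((cellOf (W k) (col k) w).filter fun y => G.Adj v y).card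
  /-- the switching-equivalent graph at every node is connected (cut form) -/
  connected : ∀ k, ∀ S ⊆ W k, S.Nonempty → S ≠ W k →
    ∃ a ∈ S, ∃ b ∈ W k \ S, (swGraph G (W k) (col k)).Adj a b
  /-- every transition before the end drops a vertex -/
  progress : ∀ k < N, W (k + 1) ≠ W k

variable {G} {N : ℕ}

namespace TransitionData

variable (T : TransitionData G N)

/-- Vertex sets decrease along the process. -/
theorem W_subset_of_le {k k' : ℕ} (h : k ≤ k') : T.W k' ⊆ T.W k := by
  induction h with
  | refl => exact Subset.rfl
  | step _ ih => exact (T.nest _).trans ih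

/-- Equal colours at a later node give equal colours at an earlier node. -/
theorem col_eq_of_le {k k' : ℕ} (h : k ≤ k') {u v : V} (hu : u ∈ T.W k') (hv : v ∈ T.W k')
    (huv : T.col k' u = T.col k' v) : T.col k u = T.col k v := by
  induction h with
  | refl => exact huv
  | step hle ih =>
    exact ih (T.nest _ hu) (T.nest _ hv)
      (T.star_refines _ u (T.nest _ hu) v (T.nest _ hv) (T.next_refines _ u hu v hv huv))

/-- **H4 from the transition data.** A vertex present at node `k` and absent at node `k'` is
homogeneous to every cell of node `k'`. -/
theorem removal_of_transitionData (k k' : ℕ) (hkk' : k < k') (v : V) (hv : v ∈ T.W k)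
    (hv' : v ∉ T.W k') (w : V) (hw : w ∈ T.W k') :
    (∀ y ∈ cellOf (T.W k') (T.col k') w, G.Adj v y) ∨ (∀ y ∈ cellOf (T.W k') (T.col k') w, ¬ G.Adj v y) := by
  -- the node `j` at which `v` is dropped: the last node `≥ k` containing `v`
  induction k' with
  | zero => exact absurd hkk' (Nat.not_lt_zero k)
  | succ j ih =>
    by_cases hvj : v ∈ T.W j
    · -- dropped exactly at the transition `j → j+1`
      have key : ∀ y ∈ cellOf (T.W (j + 1)) (T.col (j + 1)) w, (G.Adj v y ↔ G.Adj v w) := by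
        intro y hy
        rw [mem_cellOf_iff] at hy
        exact T.dropped_homogeneous j v hvj hv' y hy.1 w hw (T.next_refines j y hy.1 w hw hy.2)
      by_cases hvw : G.Adj v w
      · exact Or.inl fun y hy => (key y hy).2 hvw
      · exact Or.inr fun y hy h => hvw ((key y hy).1 h)
    · -- dropped earlier: use the induction hypothesis at node `j` for the node-`j` cell of `w`
      have hkj : k < j := by
        rcases Nat.lt_or_ge k j with h | h
        · exact h
        · exfalso
          have hjk : j = k := by omega
          subst hjk
          exact hvj hv
      have hwj : w ∈ T.W j := T.nest j hw
      have hsub : cellOf (T.W (j + 1)) (T.col (j + 1)) w ⊆ cellOf (T.W j) (T.col j) w := by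
        intro y hy
        rw [mem_cellOf_iff] at hy ⊢
        exact ⟨T.nest j hy.1, T.star_refines j y (T.nest j hy.1) w hwj (T.next_refines j y hy.1 w hw hy.2)⟩
      rcases ih hkj hvj hwj with h | h
      · exact Or.inl fun y hy => h y (hsub hy)
      · exact Or.inr fun y hy => h y (hsub hy)

/-- **Transition data yield a refinement path** (CG84-FLATNESS §9.3, T2 reduced to the per-transition
homogeneity of dropped vertices): H1b follows from the two refinement fields, H4 from
`removal_of_transitionData`; the other hypotheses are carried over. -/
def toRefinementPath : RefinementPath G N where
  W := T.W
  col := T.col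
  d := T.d
  nest := T.nest
  final := T.final
  colNest k u hu v hv huv := T.star_refines k u (T.nest k hu) v (T.nest k hv) (T.next_refines k u hu v hv huv)
  two_le := T.two_le
  d_le := T.d_le
  equitable := T.equitable
  connected := T.connected
  removal k k' hkk' v hv hv' w hw := T.removal_of_transitionData k k' hkk' v hv hv' w hw
  progress := T.progress

/-- The branching numbers of the derived refinement path are the given ones. -/
theorem toRefinementPath_d (k : ℕ) : T.toRefinementPath.d k = T.d k := rfl


/-- **Branch-sum bound for transition data** (CG84-FLATNESS Thm 9.1 via `toRefinementPath`). -/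
theorem sum_d_le [Fintype V] (T : TransitionData G N) :
    ∑ k ∈ range N, T.d k ≤ 6 * (Fintype.card V * Nat.log 2 (Fintype.card V)) :=
  T.toRefinementPath.sum_d_le

end TransitionData

end BranchSum

end Summit.PneNP.PneNP.Theorems
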